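import Summits.BirchSwinnertonDyer.BirchSwinnertonDyer.Theorems.PrintCFramBottomClassIndexLawFiveLeKrizLiBindersTwist
import Summits.BirchSwinnertonDyer.BirchSwinnertonDyer.Theorems.PrintCFramBottomClassIndexLawFiveLeKrizLiBindersKroneckerField
import Summits.BirchSwinnertonDyer.BirchSwinnertonDyer.Theorems.PrintCFramBottomClassIndexLawFiveLeAnchorBernoulli163Twin
import Summits.BirchSwinnertonDyer.BirchSwinnertonDyer.Theorems.PrintCFramBottomClassIndexLawFiveLeRegularLocusBernoulliPairOdd
import HarnessLib

/-!
# Crux `PrintCFram.BottomClassIndexLawFiveLe` (stmt-BirchSwinnertonDyer-20372), line `eisenstein-resource-bdp-line`: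
# ANCHOR BASE — the character ∧ `ε_K` ∧ Bernoulli-(4) block of the Kriz–Li datum at a BASE CURVE `A(p)` (twisting parameter `1`)
# over a Heegner field `ℚ(√−q)`, from TWO Bernoulli-unit certificates (`‖B_{1,ω^{p−1−k}}‖_p = 1`, `‖B_{1,χ_{−q}ω^{k−1}}‖_p = 1`),
# generic in the prime `p`, the exponent `k` and the prime `q`
# (cell `bsd-print-cfram`, width seat `bsd-line-cfram-p1-w3` g2; THEOREMS ONLY, `--supports` 20372; BSD is not proved by any of this)

HONEST FRAMING. Nothing here is a statement about BSD. `…KrizLiBindersAnchor163.lean` proved the block at `(A(163), 163, ℚ(√−7))`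
with the numerals in place; this file is the same argument GENERIC in `(p, k, q)`, so that the other rank-one base curves of the class
(`A(11)`, `A(19)`, `A(43)`, `A(67)`; `A(p)` has rank one iff `p ≡ 3 (mod 8)`) only need their two certificate tables
(`…KrizLiBindersAnchor11/19/43/67.lean`). For `W ∼ E` (`E` good away from `p`, trace form `a_ℓ(E) ≡ ℓ^k + ℓ^{p−k}`, `k` ODD,
`2 ≤ k ≤ p−2`): `ψ := 1↑·(ω^k)↑` (level `p·1`) is primitive, odd, with `hss`, (1), (3) (part T's engine, `m = 1`); `ψ₀⁻¹ε_K = ψ⁻¹ =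
(ω^{p−1−k})↑` and `ψ₀ω⁻¹ = (εK↑·(ω^{k−1})↑)↑` (w2 g4's odd-pair reduction + character identities); so (4) follows from the two unit
certificates by Route U's `bernoulli_hypothesis_of_certs`.

* `char_pow_sub_one`, `char_pow_inv_eq`, `char_pow_mul_inv` — `ω^{p−1} = 1`, `(ω^k)⁻¹ = ω^{p−1−k}`, `ω^k·ω⁻¹ = ω^{k−1}` for ANY
  character mod `p`;
* `thetaTwo_apply` — values of `εK↑·(ω^e)↑` at level `p·q` in the shape `(j/q)·ω(j)^e` of w2's certificate lemma
  `AnchorReduction.norm_generalizedBernoulli_legendre_teichmullerPow_of_cert`;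
* **`krizLi_characterBernoulliBlock_base`** — the block from `hcert₁`, `hcert₂`;
* **`exists_krizLiCharacterBlock_base`** — packaged over every quadratic field `K''` with `d_{K''} = −q` (`εK` from part E).

beyond-print theorem: NO. References: [KrizLi2019] Thm. 1.20, Rem. 1.21, §1.5, §2; [Rubin1983] Thm. C; [Washington1997] §5.1, Thm. 4.2;
[Cox2013] §1.C Lemma 1.14; [Gross1980] §22 (rank of `A(p)`).
-/

noncomputable section

-- summit-side namespace `Summit.BirchSwinnertonDyer.BirchSwinnertonDyer.…` (single-conjunct summit, D-0017 layout)
set_option linter.dupNamespace false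

open scoped Classical NumberTheorySymbols
open NumberField WeierstrassCurve DirichletCharacter
open Literature.NumberTheory.EllipticCurves Literature.NumberTheory.EllipticCurves.KrizLi2019
open Literature.NumberTheory.EllipticCurves.Rank1Residual Literature.NumberTheory.LFunctions
open Summit.BirchSwinnertonDyer.Rank1Residual Summit.BirchSwinnertonDyer.Rank1Residual.X12.O11

namespace Summit.BirchSwinnertonDyer.BirchSwinnertonDyer.Theorems.PrintCFram.KrizLiBinders

variable {p : ℕ} [hp : Fact p.Prime]

/-! ## §1 Character identities mod `p` -/

/-- `ω^{p−1} = 1` for every character mod `p` (values at units are `(p−1)`-st roots of unity). [cite: Washington1997, §5.1] -/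
theorem char_pow_sub_one (ω : DirichletCharacter ℚ_[p] p) : ω ^ (p - 1) = 1 := by
  refine MulChar.ext fun u => ?_
  rw [MulChar.pow_apply_coe, MulChar.one_apply_coe]
  have hu : ¬ ((p : ℤ) ∣ (((u : ZMod p).val : ℕ) : ℤ)) := by
    intro h
    have h' : p ∣ (u : ZMod p).val := by exact_mod_cast h
    have := ZMod.val_coe_unit_coprime u
    exact absurd (Nat.Coprime.eq_one_of_dvd this.symm h') hp.out.one_lt.ne'
  have := apply_pow_sub_one_eq_one ω _ hu
  simpa [ZMod.natCast_zmod_val] using this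

/-- `(ω^k)⁻¹ = ω^{p−1−k}` for `k ≤ p − 1`. [cite: Washington1997, §5.1] -/
theorem char_pow_inv_eq (ω : DirichletCharacter ℚ_[p] p) {k : ℕ} (hk : k ≤ p - 1) : (ω ^ k)⁻¹ = ω ^ (p - 1 - k) :=
  inv_eq_of_mul_eq_one_right (by rw [← pow_add, Nat.add_sub_cancel' hk]; exact char_pow_sub_one ω)

/-- `ω^k·ω⁻¹ = ω^{k−1}` for `1 ≤ k`. [folklore] -/
theorem char_pow_mul_inv (ω : DirichletCharacter ℚ_[p] p) {k : ℕ} (hk : 1 ≤ k) : ω ^ k * ω⁻¹ = ω ^ (k - 1) := by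
  conv_lhs => rw [← Nat.sub_add_cancel hk, pow_succ]
  rw [mul_inv_cancel_right]

/-- The values of `θ := εK↑·(ω^e)↑` at level `p·q` (`q ≠ p` prime, `εK` with values `J(· | q)`, `e ≠ 0`): `θ(j) = (j/q)·ω(j)^e`
at EVERY residue `j` — the shape consumed by `AnchorReduction.norm_generalizedBernoulli_legendre_teichmullerPow_of_cert`.
[cite: KrizLi2019, §2 (p. 11, conventions on characters)] -/
theorem thetaTwo_apply {q : ℕ} [hq : Fact q.Prime] (ω : DirichletCharacter ℚ_[p] p)
    (εK : DirichletCharacter ℚ_[p] q) (hεK : ∀ a : ℕ, εK (a : ZMod q) = (J((a : ℤ) | q) : ℚ_[p])) {e : ℕ} (he : e ≠ 0)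
    (j : ZMod (p * q)) :
    (changeLevel (dvd_mul_left q p) εK * changeLevel (dvd_mul_right p q) (ω ^ e) :
      DirichletCharacter ℚ_[p] (p * q)) j =
      (legendreSym q (j.val : ℤ) : ℚ_[p]) * ω (j.val : ZMod p) ^ e := by
  have hj : ((j.val : ℤ) : ZMod (p * q)) = j := by rw [Int.cast_natCast, ZMod.natCast_zmod_val]
  rw [jacobiSym.legendreSym.to_jacobiSym]
  by_cases hu : IsCoprime (j.val : ℤ) ((p * q : ℕ) : ℤ)
  · conv_lhs => rw [← hj]
    rw [MulChar.mul_apply, changeLevel_eq_cast_of_dvd' _ _ hu, changeLevel_eq_cast_of_dvd' _ _ hu,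
      MulChar.pow_apply' _ he, Int.cast_natCast, Int.cast_natCast, hεK]
  · have hnu : ¬ IsUnit j := by
      rw [← hj, ZMod.coe_int_isUnit_iff_isCoprime]; exact fun h => hu (by simpa [isCoprime_comm] using h)
    rw [MulChar.map_nonunit _ hnu]
    have h77 : ¬ (j.val).Coprime (p * q) := fun h => hu (Nat.isCoprime_iff_coprime.mpr h)
    rw [Nat.coprime_mul_iff_right, not_and_or] at h77
    rcases h77 with h7 | hmm
    · have hd : p ∣ j.val := by
        rwa [Nat.coprime_comm, Nat.Prime.coprime_iff_not_dvd hp.out, not_not] at h7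
      have h0 : (j.val : ZMod p) = 0 := (ZMod.natCast_eq_zero_iff _ _).mpr hd
      rw [h0, MulChar.map_zero, zero_pow he, mul_zero]
    · have hd : q ∣ j.val := by
        rwa [Nat.coprime_comm, Nat.Prime.coprime_iff_not_dvd hq.out, not_not] at hmm
      rw [jacobiSym.eq_zero_iff_not_coprime.mpr (by
        rw [Int.gcd_natCast_natCast]; exact fun h => by
          have := Nat.Coprime.eq_one_of_dvd (Nat.Coprime.symm h) hd
          exact hq.out.one_lt.ne' this), Int.cast_zero, zero_mul]

/-! ## §2 The block at a base curve from two certificates -/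

/-- **THE CHARACTER ∧ BERNOULLI BLOCK AT A BASE CURVE, FROM TWO CERTIFICATES.** Let `p` be an odd prime, `E/ℚ` elliptic with
good reduction away from `p` and trace form `a_ℓ(E) ≡ ℓ^k + ℓ^{p−k} (mod p)` with `k` ODD, `2 ≤ k ≤ p − 2`; `W ∼ E`; `ω`
Teichmüller mod `p`; `q ≠ p` an odd prime and `εK` a `ℚ_p`-valued character of level `d = q` with values `J(· | q)`. Assume the
two Bernoulli UNIT certificates `hcert₁ : ‖bernoulliOnePrim (ω^{p−1−k})‖ = 1` and `hcert₂ : ‖B_{1,θ}‖ = 1` for every `θ` mod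
`p·q` with values `(j/q)·ω(j)^{k−1}`. Then `ψ := 1↑·(ω^k)↑` (level `p·1`) is PRIMITIVE and ODD and satisfies `hss`, (1), (3) for
`W` and hypothesis (4) `¬ ‖B_{1,ψ₀⁻¹ε_K}·B_{1,ψ₀ω⁻¹}‖ ≤ p⁻¹`, verbatim; and `ψ(a) = ω(a)^k` for `(a, p) = 1`.
[cite: KrizLi2019, Thm. 1.20 (pp. 7–8), Rem. 1.21, §1.5, §2] [cite: Washington1997, §5.1, Thm. 4.2] -/
theorem krizLi_characterBernoulliBlock_base (hp2 : p ≠ 2) (E : WeierstrassCurve ℚ) [E.IsElliptic] {k : ℕ}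
    (hk2 : 2 ≤ k) (hkp : k ≤ p - 2) (hkodd : Odd k)
    (hgood : ∀ (r : ℕ) [Fact r.Prime], r ≠ p → E.HasGoodReductionAtPrime r)
    (hbase : ∀ (ℓ : ℕ) [Fact ℓ.Prime], ℓ ≠ p → (E.LFunction ℓ : ZMod p) = (ℓ : ZMod p) ^ k + (ℓ : ZMod p) ^ (p - k))
    (W : WeierstrassCurve ℚ) [W.IsElliptic] (hiso : IsIsogenous W E)
    (ω : DirichletCharacter ℚ_[p] p) (hω : IsTeichmullerCharacter ω)
    {q : ℕ} [hq : Fact q.Prime] (hqp : q ≠ p) (hq2 : q ≠ 2) {d : ℕ} (hd : d = q) [NeZero d]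
    (εK : DirichletCharacter ℚ_[p] d) (hεK : ∀ a : ℕ, εK (a : ZMod d) = (J((a : ℤ) | q) : ℚ_[p]))
    (hcert₁ : ‖bernoulliOnePrim (ω ^ (p - 1 - k))‖ = 1)
    (hcert₂ : ∀ θ : DirichletCharacter ℚ_[p] (p * q),
      (∀ j : ZMod (p * q), θ j = (legendreSym q (j.val : ℤ) : ℚ_[p]) * ω (j.val : ZMod p) ^ (k - 1)) →
      ‖generalizedBernoulli 1 θ‖ = 1) :
    ∃ (f : ℕ) (_ : NeZero f) (ψ : DirichletCharacter ℚ_[p] f),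
      ψ.IsPrimitive ∧ ψ.Odd ∧
      (∀ ℓ : ℕ, ℓ.Prime → ¬ (ℓ ∣ p * W.conductorNorm ℤ) →
        ‖((W.LFunction ℓ : ℤ) : ℚ_[p]) - (ψ (ℓ : ZMod f) + ψ⁻¹ (ℓ : ZMod f) * ω (ℓ : ZMod p))‖ < 1) ∧
      (ψ (p : ZMod f) ≠ 1 ∧ primVal (invMulOmega ψ ω) p ≠ 1) ∧
      (∀ ℓ : ℕ, (hℓ : ℓ.Prime) → ℓ ≠ p →
        (haveI := Fact.mk hℓ; ¬ W.HasGoodReductionAtPrime ℓ ∧ ¬ W.HasMultiplicativeReductionAtPrime ℓ) →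
        ψ (ℓ : ZMod f) ≠ 1 ∧ primVal (invMulOmega ψ ω) ℓ ≠ 1) ∧
      ¬ (‖bernoulliOnePrim (bernoulliCharOne ψ εK) * bernoulliOnePrim (bernoulliCharTwo ψ εK ω)‖ ≤ (p : ℝ)⁻¹) ∧
      (∀ a : ℕ, a.Coprime p → ψ (a : ZMod f) = ω (a : ZMod p) ^ k) := by
  have hd' := hd.symm
  subst hd'
  have hpp : p.Prime := hp.out
  -- the engine with `m = 1`, `χ = 1`
  have h1prim : (1 : DirichletCharacter ℚ_[p] 1).IsPrimitive := by
    rw [isPrimitive_def, conductor_one]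
  have h1quad : (1 : DirichletCharacter ℚ_[p] 1).IsQuadratic := fun a =>
    Or.inr (Or.inl (MulChar.one_apply (isUnit_of_subsingleton a)))
  have hval1 : ∀ a : ℕ, (1 : DirichletCharacter ℚ_[p] 1) (a : ZMod 1) = ((1 : ℤ) : ℚ_[p]) := fun a => by
    rw [MulChar.one_apply (isUnit_of_subsingleton _), Int.cast_one]
  have hLW : W.LFunction = E.LFunction := hiso.LFunction_eq
  have htr : ∀ ℓ : ℕ, ℓ.Prime → ℓ ≠ p →
      ((W.LFunction ℓ : ℤ) : ZMod p) = ((1 : ℤ) : ZMod p) * ((ℓ : ZMod p) ^ k + (ℓ : ZMod p) ^ (p - k)) := by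
    intro ℓ hℓ hne
    haveI := Fact.mk hℓ
    rw [hLW, Int.cast_one, one_mul]
    exact hbase ℓ hne
  have hgoodW : ∀ ℓ : ℕ, (hℓ : ℓ.Prime) → ℓ ≠ p → ¬ ℓ ∣ 1 → (haveI := Fact.mk hℓ; W.HasGoodReductionAtPrime ℓ) := by
    intro ℓ hℓ hne _
    haveI := Fact.mk hℓ
    exact (hiso.hasGoodReductionAtPrime_iff ℓ).mpr (hgood ℓ hne)
  obtain ⟨hprim, hss, h1, h3⟩ := krizLiBinders_of_data (p := p) hp2 W (1 : DirichletCharacter ℚ_[p] 1)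
    h1prim h1quad (Nat.coprime_one_left p) (fun _ => 1) (fun a _ _ => hval1 a) hk2 hkp htr hgoodW ω hω
  set ψ : DirichletCharacter ℚ_[p] (p * 1) :=
    changeLevel (dvd_mul_left 1 p) (1 : DirichletCharacter ℚ_[p] 1) * changeLevel (dvd_mul_right p 1) (ω ^ k)
    with hψdef
  -- parity and values
  have hodd : ψ.Odd := by
    rw [hψdef]
    refine psi_odd_of ω (1 : DirichletCharacter ℚ_[p] 1) k hp2 hω (by omega) ?_
    rw [MulChar.one_apply (isUnit_of_subsingleton _), hkodd.neg_one_pow]; norm_num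
  have hnev : ¬ ψ.Even := hodd.not_even
  have hval : ∀ a : ℕ, a.Coprime p → ψ (a : ZMod (p * 1)) = ω (a : ZMod p) ^ k := by
    intro a ha
    rw [hψdef, psi_apply_natCast_of_coprime ω (1 : DirichletCharacter ℚ_[p] 1) k (by omega) (by simpa using ha),
      MulChar.one_apply (isUnit_of_subsingleton _), one_mul]
  haveI : NeZero (p * 1) := ⟨by simpa using hpp.ne_zero⟩
  refine ⟨p * 1, inferInstance, ψ, hprim, hodd, hss, h1, h3, ?_, hval⟩
  -- (4): `θ₁ = ω^{p−1−k}`, `θ₂ = εK↑·(ω^{k−1})↑`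
  have hψinv : ψ⁻¹ = changeLevel (dvd_mul_right p 1) (ω ^ (p - 1 - k)) := by
    rw [hψdef, changeLevel_one, one_mul, ← map_inv, char_pow_inv_eq ω (by omega)]
  have hθ₁ne : ω ^ (p - 1 - k) ≠ 1 := teichmuller_pow_ne_one hω (by omega) (by omega)
  have hθ₁ : (ω ^ (p - 1 - k)).IsPrimitive := by
    rw [isPrimitive_def]; exact RouteU.conductor_eq_of_prime_of_ne_one _ hθ₁ne
  have hu₁ : ‖generalizedBernoulli 1 (ω ^ (p - 1 - k))‖ = 1 := by
    rw [← RouteU.bernoulliOnePrim_eq_of_isPrimitive _ hθ₁]; exact hcert₁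
  have hχ₁ : bernoulliCharOne ψ εK =
      changeLevel ((dvd_mul_right p 1).trans (dvd_mul_right (p * 1) q)) (ω ^ (p - 1 - k)) := by
    rw [RegularLocusBernoulliPair.bernoulliCharOne_of_not_even ψ εK hnev, hψinv, ← changeLevel_trans]
  set θ₂ : DirichletCharacter ℚ_[p] (p * q) :=
    changeLevel (dvd_mul_left q p) εK * changeLevel (dvd_mul_right p q) (ω ^ (k - 1)) with hθ₂def
  have hqodd : Odd q := hq.out.odd_of_ne_two hq2
  have hεKprim : εK.IsPrimitive :=
    isPrimitive_of_forall_eq_jacobiSym hεK hqodd (Nat.prime_iff.mp hq.out).squarefree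
  have hωk1 : ω ^ (k - 1) ≠ 1 := teichmuller_pow_ne_one hω (by omega) (by omega)
  have hθ₂ : θ₂.IsPrimitive := by
    have hcq : εK.conductor = q := hεKprim
    have hcp : (ω ^ (k - 1)).conductor = p := RouteU.conductor_eq_of_prime_of_ne_one _ hωk1
    rw [isPrimitive_def, hθ₂def, RouteU.conductor_changeLevel_mul_changeLevel _ _ εK (ω ^ (k - 1))
      (by rw [hcq, hcp]; exact (Nat.coprime_primes hq.out hpp).mpr hqp), hcq, hcp, mul_comm]
  have hu₂ : ‖generalizedBernoulli 1 θ₂‖ = 1 := hcert₂ θ₂ (thetaTwo_apply ω εK hεK (by omega))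
  have h₂ : p * q ∣ p * 1 * q * p := ⟨p, by ring⟩
  have hχ₂ : bernoulliCharTwo ψ εK ω = changeLevel h₂ θ₂ := by
    rw [RegularLocusBernoulliPair.bernoulliCharTwo_of_not_even ψ εK ω hnev, hθ₂def, hψdef]
    simp only [map_mul, changeLevel_one, one_mul, ← changeLevel_trans]
    rw [← char_pow_mul_inv ω (by omega : 1 ≤ k), map_mul, mul_comm (changeLevel _ (ω ^ k)) (changeLevel _ εK)]
    exact mul_assoc _ _ _
  exact RouteU.bernoulli_hypothesis_of_certs (ω ^ (p - 1 - k)) hθ₁ _ θ₂ hθ₂ h₂ _ hχ₁ _ hχ₂ hu₁ hu₂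

/-- **The block packaged over every quadratic field `K''` of discriminant `−q`** (`q ≡ 3 (mod 4)` prime, `q ≠ p`): with `ω` from
`exists_isTeichmullerCharacter` and `εK` from part E's `exists_isKroneckerCharacterOf_of_discr`, the two certificates give
`∃ f ψ ω εK, ψ.IsPrimitive ∧ IsTeichmullerCharacter ω ∧ hss ∧ (1) ∧ (3) ∧ IsKroneckerCharacterOf K'' εK ∧ (4) ∧ ψ.Odd` — the
hypotheses `f ψ ω hψ hω hss h1 h1' h3 εK hεK h4` of the LEAD's Kriz–Li-datum theorems at `(W ∼ E, p, K'')`.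
[cite: KrizLi2019, Thm. 1.20 (pp. 7–8), Rem. 1.21, §2 (p. 12)] [cite: Cox2013, §1.C Lemma 1.14] -/
theorem exists_krizLiCharacterBlock_base (hp2 : p ≠ 2) (E : WeierstrassCurve ℚ) [E.IsElliptic] {k : ℕ}
    (hk2 : 2 ≤ k) (hkp : k ≤ p - 2) (hkodd : Odd k)
    (hgood : ∀ (r : ℕ) [Fact r.Prime], r ≠ p → E.HasGoodReductionAtPrime r)
    (hbase : ∀ (ℓ : ℕ) [Fact ℓ.Prime], ℓ ≠ p → (E.LFunction ℓ : ZMod p) = (ℓ : ZMod p) ^ k + (ℓ : ZMod p) ^ (p - k))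
    (W : WeierstrassCurve ℚ) [W.IsElliptic] (hiso : IsIsogenous W E)
    {q : ℕ} [hq : Fact q.Prime] (hqp : q ≠ p) (hq4 : q % 4 = 3)
    (K : Type) [Field K] [NumberField K] (hK2 : Module.finrank ℚ K = 2) (hdK : NumberField.discr K = -(q : ℤ))
    [NeZero (NumberField.discr K).natAbs]
    (hcert₁ : ∀ ω : DirichletCharacter ℚ_[p] p, IsTeichmullerCharacter ω → ‖bernoulliOnePrim (ω ^ (p - 1 - k))‖ = 1)
    (hcert₂ : ∀ ω : DirichletCharacter ℚ_[p] p, IsTeichmullerCharacter ω → ∀ θ : DirichletCharacter ℚ_[p] (p * q),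
      (∀ j : ZMod (p * q), θ j = (legendreSym q (j.val : ℤ) : ℚ_[p]) * ω (j.val : ZMod p) ^ (k - 1)) →
      ‖generalizedBernoulli 1 θ‖ = 1) :
    ∃ (f : ℕ) (_ : NeZero f) (ψ : DirichletCharacter ℚ_[p] f) (ω : DirichletCharacter ℚ_[p] p)
      (εK : DirichletCharacter ℚ_[p] (NumberField.discr K).natAbs),
      ψ.IsPrimitive ∧ IsTeichmullerCharacter ω ∧
      (∀ ℓ : ℕ, ℓ.Prime → ¬ (ℓ ∣ p * W.conductorNorm ℤ) →
        ‖((W.LFunction ℓ : ℤ) : ℚ_[p]) - (ψ (ℓ : ZMod f) + ψ⁻¹ (ℓ : ZMod f) * ω (ℓ : ZMod p))‖ < 1) ∧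
      (ψ (p : ZMod f) ≠ 1 ∧ primVal (invMulOmega ψ ω) p ≠ 1) ∧
      (∀ ℓ : ℕ, (hℓ : ℓ.Prime) → ℓ ≠ p →
        (haveI := Fact.mk hℓ; ¬ W.HasGoodReductionAtPrime ℓ ∧ ¬ W.HasMultiplicativeReductionAtPrime ℓ) →
        ψ (ℓ : ZMod f) ≠ 1 ∧ primVal (invMulOmega ψ ω) ℓ ≠ 1) ∧
      IsKroneckerCharacterOf K εK ∧
      ¬ (‖bernoulliOnePrim (bernoulliCharOne ψ εK) * bernoulliOnePrim (bernoulliCharTwo ψ εK ω)‖ ≤ (p : ℝ)⁻¹) ∧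
      ψ.Odd := by
  have hq2 : q ≠ 2 := by rintro rfl; norm_num at hq4
  obtain ⟨ω, hω⟩ := exists_isTeichmullerCharacter (p := p)
  obtain ⟨εK, hεK, hεKval⟩ := exists_isKroneckerCharacterOf_of_discr (p := p) hK2
    (Nat.prime_iff.mp hq.out).squarefree (Or.inr ⟨hdK, hq4⟩)
  have hd : (NumberField.discr K).natAbs = q := by rw [hdK]; simp
  obtain ⟨f, hf, ψ, hprim, hodd, hss, h1, h3, h4, -⟩ :=
    krizLi_characterBernoulliBlock_base hp2 E hk2 hkp hkodd hgood hbase W hiso ω hω hqp hq2 hd εK hεKval (hcert₁ ω hω) (hcert₂ ω hω)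
  exact ⟨f, hf, ψ, ω, εK, hprim, hω, hss, h1, h3, hεK, h4, hodd⟩

end Summit.BirchSwinnertonDyer.BirchSwinnertonDyer.Theorems.PrintCFram.KrizLiBinders

end
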